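import Mathlib.Combinatorics.SetFamily.FourFunctions
import Mathlib.Tactic
import HarnessLib
import HarnessLib.Audit.Tags
import Summits.CriticalPhenomena.PercolationContinuityZ3.Theorems.PercNearOneGluingNoHeavyLowerTailSahiColouredDaykin
import Summits.CriticalPhenomena.PercolationContinuityZ3.Theorems.PercNearOneGluingNoHeavyLowerTailSahiColouredDaykinCross
import Summits.CriticalPhenomena.PercolationContinuityZ3.Theorems.PercNearOneGluingNoHeavyLowerTailSahiColouredDaykinZmin

/-!
# Crossing signed coloured Daykin: `CrossThirdClassFree` (smallest class) is FALSE on `2^6`; the surviving form is "SOME class is free"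

Support file (seat `prim-masterthm-p1`, gen 29; `--supports stmt-CriticalPhenomena-4575`).  One typed conjecture (`CrossSomeClassFree`), one kernel
refutation, one reduction; no `sorry`, standard axioms.  Memo `run/shared/lean/prim/prim-masterthm/FROM-prim-masterthm-p1-g29-MS-EQUALITY.md` §7.

CORRECTION to `…SahiColouredDaykinZmin` (p398964, filed an hour earlier on the evidence of `2^4`, `2^5` exhaustive and ≈52 000 random configurations of
`2^6, 2^7`): the EXHAUSTIVE census of all 447 151 200 crossing three-colour configurations of `2^6` (kit j238539 / j238612) found 21 600 configurations in
which a smallest colour class is NOT free.  `not_crossThirdClassFree_fin6` records one in the kernel: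
`P₀ = {23, 023, 235}`, `P₁ = {124, 134}`, `P₂ = {013, 135}` (`F = {0,…,5}`), `i = 2`: `Q = P₀ ∪ P̃₁ = {23, 023, 235, 035, 025}` and
`(Q \\ Q) ∪ (P₂ \\ P₂) = {∅, 0, 2, 3, 5, 05}` has 6 < 7 = #P members (the other smallest class, `i = 1`, gives 10).

WHAT SURVIVES (same census, exhaustive on `2^≤6`): in EVERY crossing configuration SOME colour class is free — the three choices of `i` never fail together
(one fails in 1 027 440 configurations, two in 63 360, three in 0), and choosing `i` with `#(Q_i \\ Q_i) − #Q_i` maximal never fails.  Hence the typed conjecture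
`CrossSomeClassFree` below, which still implies `CrossSignedColouredDaykin3` (`crossSignedColouredDaykin3_of_crossSomeClassFree`) and whose singleton-class
instances are the strict Marica–Schönheim theorem of gen 29.  HONEST FRAMING: conjecture + reduction + one refutation. [this work]
-/

namespace Summit.CriticalPhenomena.PercolationContinuityZ3.Theorems.SahiColouredDaykin

open Finset
open scoped FinsetFamily

variable {α : Type*} [DecidableEq α]

/-! ### 1. The smallest-class form is false -/

/-- The positive family of the `2^6` counterexample. [this work] -/
private def cexP : Finset (Finset (Fin 6)) :=
  {{2, 3}, {0, 2, 3}, {2, 3, 5}, {1, 2, 4}, {1, 3, 4}, {0, 1, 3}, {1, 3, 5}}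

/-- Its colouring: `{23, 023, 235} ↦ 0`, `{124, 134} ↦ 1`, everything else `↦ 2`. [this work] -/
private def cexC (S : Finset (Fin 6)) : Fin 3 :=
  if S = {2, 3} ∨ S = {0, 2, 3} ∨ S = {2, 3, 5} then 0 else if S = {1, 2, 4} ∨ S = {1, 3, 4} then 1 else 2

/-- **`CrossThirdClassFree` fails on `Fin 6`** (exhaustive census of `2^6`, kit j238539; this is one of 21 600 counterexamples). [this work] -/
theorem not_crossThirdClassFree_fin6 : ¬ CrossThirdClassFree (Fin 6) := by
  intro h
  have h1 : ∀ S ∈ cexP, S ⊆ (univ : Finset (Fin 6)) := fun S _ => subset_univ S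
  have h2 : ∀ S ∈ cexP, ∀ T ∈ cexP, cexC S ≠ cexC T → ¬ S ⊆ T := by decide
  have h3 : ∀ S ∈ cexP, ∀ T ∈ cexP, (S ∩ T).Nonempty ∧ S ∪ T ≠ (univ : Finset (Fin 6)) := by decide
  have h4 : ∀ j : Fin 3, #(cexP.filter fun S => cexC S = 2) ≤ #(cexP.filter fun S => cexC S = j) := by decide
  have h5 := h univ cexP cexC 2 h1 h2 h3 h4
  revert h5
  decide

/-! ### 2. The surviving form: some class is free -/

/-- **CONJECTURE ("some colour class is free").**  In a crossing three-colour configuration there is a colour `i` such that the differences of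
`Q = P_{i+1} ∪ P̃_{i+2}` together with the differences inside `P_i` number at least `#P`.  Exhaustive on `2^n`, `n ≤ 6` (447 151 200 configurations
of `2^6`; the choice "`i` with `#(Q \\ Q) − #Q` maximal" never fails); singleton classes: strict Marica–Schönheim (gen 29). [this work] [status: open] -/
@[conjecture] def CrossSomeClassFree (α : Type*) [DecidableEq α] : Prop :=
  ∀ (F : Finset α) (P : Finset (Finset α)) (c : Finset α → Fin 3),
    (∀ S ∈ P, S ⊆ F) →
    (∀ S ∈ P, ∀ T ∈ P, c S ≠ c T → ¬ S ⊆ T) →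
    (∀ S ∈ P, ∀ T ∈ P, (S ∩ T).Nonempty ∧ S ∪ T ≠ F) →
    ∃ i : Fin 3, #P ≤ #((thirdFreeFamily F P c i \\ thirdFreeFamily F P c i) ∪ ((P.filter fun S => c S = i) \\ (P.filter fun S => c S = i)))

/-- Complementation inside `F` is injective on subfamilies of `2^F`. [folklore] -/
private theorem sdiff_injOn_of_subset' (F : Finset α) (𝒜 : Finset (Finset α)) (h𝒜 : ∀ S ∈ 𝒜, S ⊆ F) :
    Set.InjOn (fun S => F \ S) ↑𝒜 := by
  intro S hS S' hS' h
  have hSF := h𝒜 S (mem_coe.1 hS)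
  have hS'F := h𝒜 S' (mem_coe.1 hS')
  have : F \ (F \ S) = F \ (F \ S') := by
    show F \ ((fun S => F \ S) S) = F \ ((fun S => F \ S) S')
    rw [h]
  rwa [Finset.sdiff_sdiff_eq_self hSF, Finset.sdiff_sdiff_eq_self hS'F] at this

/-- Every difference of `Q = P_{i+1} ∪ P̃_{i+2}` and every difference inside `P_i` lies in `2^F` and has its complement among the compatible unions. [this work] -/
private theorem compl_mem_compatJoins_of_mem' (F : Finset α) (P : Finset (Finset α)) (c : Finset α → Fin 3) (i : Fin 3)
    (hPF : ∀ S ∈ P, S ⊆ F) {Z : Finset α}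
    (hZ : Z ∈ (thirdFreeFamily F P c i \\ thirdFreeFamily F P c i) ∪ ((P.filter fun S => c S = i) \\ (P.filter fun S => c S = i))) :
    Z ⊆ F ∧ F \ Z ∈ compatJoins F P c := by
  have hab : i + 1 ≠ i + 2 := by
    have : ∀ x : Fin 3, x + 1 ≠ x + 2 := by decide
    exact this i
  rcases mem_union.1 hZ with hZ | hZ
  · obtain ⟨X, hX, Y, hY, rfl⟩ := mem_diffs.1 hZ
    unfold thirdFreeFamily at hX hY
    rcases mem_union.1 hX with hX | hX <;> rcases mem_union.1 hY with hY | hY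
    · obtain ⟨haP, hai⟩ := mem_filter.1 hX
      obtain ⟨ha'P, ha'i⟩ := mem_filter.1 hY
      refine ⟨sdiff_subset.trans (hPF X haP), ?_⟩
      have e : F \ (X \ Y) = Y ∪ (F \ X) := by
        ext x
        have h1 : x ∈ Y → x ∈ F := fun h => hPF Y ha'P h
        simp only [mem_sdiff, mem_union]
        tauto
      rw [e]
      exact union_sdiff_mem_compatJoins ha'P haP (by rw [ha'i, hai])
    · obtain ⟨haP, hai⟩ := mem_filter.1 hX
      obtain ⟨bb, hb, rfl⟩ := mem_image.1 hY
      obtain ⟨hbP, hbj⟩ := mem_filter.1 hb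
      refine ⟨sdiff_subset.trans (hPF X haP), ?_⟩
      have e : F \ (X \ (F \ bb)) = (F \ X) ∪ (F \ bb) := by
        ext x
        have h1 : x ∈ X → x ∈ F := fun h => hPF X haP h
        simp only [mem_sdiff, mem_union]
        tauto
      rw [e]
      exact sdiff_union_sdiff_mem_compatJoins haP hbP (by rw [hai, hbj]; exact hab)
    · obtain ⟨bb, hb, rfl⟩ := mem_image.1 hX
      obtain ⟨hbP, hbj⟩ := mem_filter.1 hb
      obtain ⟨haP, hai⟩ := mem_filter.1 hY
      refine ⟨sdiff_subset.trans sdiff_subset, ?_⟩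
      have e : F \ ((F \ bb) \ Y) = Y ∪ bb := by
        ext x
        have h1 : x ∈ Y → x ∈ F := fun h => hPF Y haP h
        have h2 : x ∈ bb → x ∈ F := fun h => hPF bb hbP h
        simp only [mem_sdiff, mem_union]
        tauto
      rw [e]
      exact union_mem_compatJoins haP hbP (by rw [hai, hbj]; exact hab)
    · obtain ⟨bb, hb, rfl⟩ := mem_image.1 hX
      obtain ⟨hbP, hbj⟩ := mem_filter.1 hb
      obtain ⟨b', hb', rfl⟩ := mem_image.1 hY
      obtain ⟨hb'P, hb'j⟩ := mem_filter.1 hb'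
      refine ⟨sdiff_subset.trans sdiff_subset, ?_⟩
      have e : F \ ((F \ bb) \ (F \ b')) = bb ∪ (F \ b') := by
        ext x
        have h2 : x ∈ bb → x ∈ F := fun h => hPF bb hbP h
        simp only [mem_sdiff, mem_union]
        tauto
      rw [e]
      exact union_sdiff_mem_compatJoins hbP hb'P (by rw [hbj, hb'j])
  · obtain ⟨X, hX, Y, hY, rfl⟩ := mem_diffs.1 hZ
    obtain ⟨hXP, hXi⟩ := mem_filter.1 hX
    obtain ⟨hYP, hYi⟩ := mem_filter.1 hY
    refine ⟨sdiff_subset.trans (hPF X hXP), ?_⟩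
    have e : F \ (X \ Y) = Y ∪ (F \ X) := by
      ext x
      have h1 : x ∈ Y → x ∈ F := fun h => hPF Y hYP h
      simp only [mem_sdiff, mem_union]
      tauto
    rw [e]
    exact union_sdiff_mem_compatJoins hYP hXP (by rw [hYi, hXi])

/-- **"Some class is free" ⟹ `CrossSignedColouredDaykin3`.** [this work] -/
theorem crossSignedColouredDaykin3_of_crossSomeClassFree (h : CrossSomeClassFree α) : CrossSignedColouredDaykin3 α := by
  intro F P c hPF hinc hcross
  obtain ⟨i, hi⟩ := h F P c hPF hinc hcross
  set U := (thirdFreeFamily F P c i \\ thirdFreeFamily F P c i) ∪ ((P.filter fun S => c S = i) \\ (P.filter fun S => c S = i)) with hU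
  have hmem : ∀ Z ∈ U, Z ⊆ F ∧ F \ Z ∈ compatJoins F P c := fun Z hZ => compl_mem_compatJoins_of_mem' F P c i hPF hZ
  have hinj : Set.InjOn (fun Z => F \ Z) ↑U := sdiff_injOn_of_subset' F U fun Z hZ => (hmem Z hZ).1
  have hsub : U.image (fun Z => F \ Z) ⊆ compatJoins F P c := by
    intro W hW
    obtain ⟨Z, hZ', rfl⟩ := mem_image.1 hW
    exact (hmem Z hZ').2
  calc #P ≤ #U := hi
    _ = #(U.image fun Z => F \ Z) := (card_image_of_injOn hinj).symm
    _ ≤ #(compatJoins F P c) := card_le_card hsub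

end Summit.CriticalPhenomena.PercolationContinuityZ3.Theorems.SahiColouredDaykin
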